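import Mathlib
import Literature.Analysis.FluidPDE.SteadyNSLatticePersistenceDrift
import Summits.AnomalousDissipation.AnomalousDissipation.Theorems.WindLineWindyGalerkinSteadyZerothLawForceDictionary
import Summits.AnomalousDissipation.AnomalousDissipation.Theorems.WindLineWindyGalerkinSteadyZerothLawLinearisationInjective
import Summits.AnomalousDissipation.AnomalousDissipation.Theorems.BaireTransferRobustLoudUpgradeStubRealKernel
import Summits.AnomalousDissipation.AnomalousDissipation.Theorems.BaireTransferRobustLoudUpgradeStubLsTransfer

/-!
# Generic leaf-nondegeneracy (stub B of crux `WindLine.WindyGalerkinSteadyZerothLaw`,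
# stmt-AnomalousDissipation-11414), tools C: the dictionary between admissible parameters,
# classical steady states and the steady Fourier lattice

Helper layer (pure proof file, no definitions).  Parameters are the closed subset
`𝒜 ⊆ SymL2 (Fin 3)` (no mean mode, transversal coefficients) and the force of `c ∈ 𝒜` is
`F⟦c⟧ = SymL2.field (k ↦ e^{|k|²}) c` (Fourier coefficients `e^{-|k|²} c k`, landed dictionary
`…Theorems/WindLineWindyGalerkinSteadyZerothLawForceDictionary.lean`).  On the state space
`W ⊂ ℓ²(ℤ³; ℂ³)` of `SteadyLattice` (zero mean, transversal, conjugate symmetric; an element `x`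
represents `û° = cf x`, the punctured Fourier family of the fluctuation) with bilinear map `B`
and drift `D_M` (`M = û(0)` the mean):

* `exists_forceVecMap` — the **force vectors** `Y c ∈ W` (coordinates `𝓕(F⟦c⟧)(k) = e^{-|k|²} c k`),
  `1`-Lipschitz in `c`;
* `exists_stateVec_of_family`, `exists_stateVec` — the **state vector** `x_u ∈ W` of a smooth
  divergence-free field `u` (coordinates `|k|² û(k)`, `cf x_u = û°`);
* `steadyMap_stateVec_eq` — a classical steady state of `NS_ν(F⟦c⟧)` solves the drifted lattice
  equation `4π²ν x_u + D_M x_u + B(x_u,x_u) = Y c`, `M = û(0)` (`fourier_eq_drift_of_isSteadyNSState`);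
* `exists_steadyState_of_latticeEq` — conversely a lattice solution synthesises a classical steady
  state of `NS_ν(F⟦c⟧)` with `𝓕u = cf x + δ₀ M` (`rapidDecay_of_perturbed_eq`, `steadyState_of_fourier'`);
* `exists_kernel_of_isLinNSEigenvalue` — a classical kernel field of the linearisation `L(ν,u)` in the
  mean-zero class (`IsLinNSEigenvalue ν u 0`) yields a NON-ZERO kernel vector of the lattice
  linearisation `4π²ν + D + K` (`stub_realKernel`: a real kernel field; `latticeEq_of_linNSResolventRel`:
  its lattice equation) — the converse of the landed `stub_linearisationInjective`.

References: Temam 1979 Ch. II §1; Foias–Temam, CPAM 30 (1977) §1; Constantin–Foias 1988 Ch. 10.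
-/

noncomputable section

-- D-0017: single-problem summit ⇒ the duplicated namespace segment is by design.
set_option linter.dupNamespace false

open scoped BigOperators Topology ENNReal NNReal InnerProductSpace ComplexConjugate
open Filter Set Function TopologicalSpace MeasureTheory UnitAddTorus
open Literature.Analysis.FunctionSpaces Literature.Analysis.FunctionSpaces.Torus
open Literature.Analysis.FunctionSpaces.EuclideanSpace
open Literature.Analysis.FluidPDE Literature.Analysis.FluidPDE.Torus
open Literature.Analysis.FluidPDE.ScalarFourier
open Literature.Analysis.FluidPDE.SteadyLattice Literature.Analysis.FluidPDE.SteadyLatticeDrift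
open Summit.AnomalousDissipation.AnomalousDissipation.Theorems.RobustLoudUpgrade

namespace Summit.AnomalousDissipation.AnomalousDissipation.Theorems.WindLineWindyGalerkinSteadyZerothLaw.GenericLeaf

/-- The flat three-torus (local notation). -/
local notation "𝕋³" => UnitAddTorus (Fin 3)
/-- Velocity values (local notation). -/
local notation "E³" => EuclideanSpace ℝ (Fin 3)
/-- Complex coefficient vectors (local notation). -/
local notation "ℂ³" => EuclideanSpace ℂ (Fin 3)
/-- Square-summable coefficient families `ℤ³ → ℂ³` (local notation). -/
local notation "ℓ2" => lp (fun _ : Fin 3 → ℤ => EuclideanSpace ℂ (Fin 3)) 2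
/-- Physical coefficients `x̌(k) = x(k)/|k|²` of a family (local notation, the tree's `cf`). -/
local notation "cf[" X "]" =>
  ((fun mm : Fin 3 → ℤ => (((freqNormSq mm)⁻¹ : ℝ) : ℂ)) • (X : (Fin 3 → ℤ) → EuclideanSpace ℂ (Fin 3)))
/-- `k · v = ∑ⱼ kⱼ vⱼ` (local notation, the tree's `kdot`). -/
local notation "kdot[" k "," v "]" =>
  (∑ jj : Fin 3, (((k : Fin 3 → ℤ) jj : ℤ) : ℂ) * (v : EuclideanSpace ℂ (Fin 3)) jj)
/-- The convective symbol `N(a, b)(k)` as a vector of `ℂ³` (local notation, the tree's `nl`). -/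
local notation "nl[" a "," b "," k "]" =>
  ((WithLp.toLp 2 (fun pp : Fin 3 => transportSym (fun jj mm => (a : (Fin 3 → ℤ) → EuclideanSpace ℂ (Fin 3)) mm jj)
    (fun mm => (b : (Fin 3 → ℤ) → EuclideanSpace ℂ (Fin 3)) mm pp) k)) : EuclideanSpace ℂ (Fin 3))
set_option quotPrecheck false in
/-- admissible parameters -/
local notation "𝒜" => ({c : SymL2 (Fin 3) | c 0 = 0 ∧
  ∀ k : Fin 3 → ℤ, ∑ j : Fin 3, ((k j : ℤ) : ℂ) * c k j = 0} : Set (SymL2 (Fin 3)))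
/-- the force of a parameter -/
local notation "F⟦" c "⟧" => SymL2.field (fun k : Fin 3 → ℤ => Real.exp (freqNormSq k)) (c : SymL2 (Fin 3))

variable {W : Submodule ℝ ℓ2}
variable (hW : ∀ x : ℓ2, x ∈ W ↔ (((x : ℓ2) : (Fin 3 → ℤ) → ℂ³) 0 = 0 ∧
  (∀ kk : Fin 3 → ℤ, kdot[kk, ((x : ℓ2) : (Fin 3 → ℤ) → ℂ³) kk] = 0) ∧ IsConjSymm ((x : ℓ2) : (Fin 3 → ℤ) → ℂ³)))

/-! ## §1 Force vectors -/

/-- The Fourier coefficients of `F⟦c⟧` are the Gaussian-damped coefficients `coef w c`. [folklore] -/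
theorem mFourierCoeff_force (c : SymL2 (Fin 3)) (k : Fin 3 → ℤ) :
    mFourierCoeff (complexify ∘ F⟦c⟧) k = SymL2.coef (fun k : Fin 3 → ℤ => Real.exp (freqNormSq k)) c k :=
  SymL2.mFourierCoeff_field forceDict_isWeight forceDict_summable_inv_sq c k

/-- `‖coef w c k‖ ≤ ‖c k‖` for the Gaussian weight (`w ≥ 1`). [folklore] -/
theorem norm_coef_le (c : SymL2 (Fin 3)) (k : Fin 3 → ℤ) :
    ‖SymL2.coef (fun k : Fin 3 → ℤ => Real.exp (freqNormSq k)) c k‖ ≤ ‖c k‖ := by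
  rw [SymL2.norm_coef forceDict_isWeight]
  exact mul_le_of_le_one_left (norm_nonneg _) (inv_le_one_of_one_le₀ (Real.one_le_exp (freqNormSq_nonneg k)))

/-- `∑ₖ ‖coef w c k‖² ≤ ‖c‖²` in `ℝ≥0∞`. [folklore] -/
theorem tsum_enorm_sq_coef_le (c : SymL2 (Fin 3)) :
    ∑' k, ‖SymL2.coef (fun k : Fin 3 → ℤ => Real.exp (freqNormSq k)) c k‖ₑ ^ 2 ≤ ‖c‖ₑ ^ 2 := by
  have hs := SymL2.hasSum_norm_sq c
  have h1 : ∑' k, ‖SymL2.coef (fun k : Fin 3 → ℤ => Real.exp (freqNormSq k)) c k‖ₑ ^ 2 ≤ ∑' k, ‖c k‖ₑ ^ 2 := by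
    refine ENNReal.tsum_le_tsum fun k => pow_le_pow_left' ?_ 2
    rw [← ofReal_norm, ← ofReal_norm]
    exact ENNReal.ofReal_le_ofReal (norm_coef_le c k)
  refine h1.trans (le_of_eq ?_)
  rw [← ofReal_norm, ← ENNReal.ofReal_pow (norm_nonneg _), ← hs.tsum_eq,
    ENNReal.ofReal_tsum_of_nonneg (fun k => sq_nonneg _) hs.summable]
  exact tsum_congr fun k => by rw [← ofReal_norm, ENNReal.ofReal_pow (norm_nonneg _)]

include hW in
/-- **The force vectors.**  There is a map `Y : 𝒜 → W` with coordinates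
`(Y c)(k) = 𝓕(F⟦c⟧)(k) = e^{-|k|²} c k`, and it is `1`-Lipschitz: `‖Y c − Y c'‖ ≤ ‖c − c'‖`
(in particular `‖Y c‖ ≤ ‖c‖`). [folklore] -/
theorem exists_forceVecMap : ∃ Y : 𝒜 → W,
    (∀ (c : 𝒜) (k : Fin 3 → ℤ), (((Y c : W) : ℓ2) : (Fin 3 → ℤ) → ℂ³) k = mFourierCoeff (complexify ∘ F⟦c⟧) k) ∧
    (∀ c : 𝒜, ‖Y c‖ ≤ ‖(c : SymL2 (Fin 3))‖) ∧
    (∀ c c' : 𝒜, ‖Y c - Y c'‖ ≤ ‖(c : SymL2 (Fin 3)) - c'‖) := by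
  set w : (Fin 3 → ℤ) → ℝ := fun k => Real.exp (freqNormSq k) with hw
  -- the `ℓ²` element of a parameter
  have hmem : ∀ c : SymL2 (Fin 3), Memℓp (SymL2.coef w c) 2 := fun c =>
    memℓp_two_of_tsum_ne_top (ne_top_of_le_ne_top (ENNReal.pow_ne_top enorm_ne_top) (tsum_enorm_sq_coef_le c))
  have hV : ∀ c : 𝒜, ((SymL2.coef w c : (Fin 3 → ℤ) → ℂ³) 0 = 0 ∧
      (∀ kk : Fin 3 → ℤ, kdot[kk, (SymL2.coef w c : (Fin 3 → ℤ) → ℂ³) kk] = 0) ∧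
      IsConjSymm (SymL2.coef w c : (Fin 3 → ℤ) → ℂ³)) := by
    intro c
    obtain ⟨h0, htr⟩ := c.2
    refine ⟨by rw [SymL2.coef_apply, h0, smul_zero], fun k => ?_, SymL2.isConjSymm_coef forceDict_isWeight _⟩
    rw [SymL2.coef_apply, kdot_smul, htr k, mul_zero]
  set Y : 𝒜 → W := fun c => ⟨⟨SymL2.coef w c, hmem c⟩, (hW _).2 (hV c)⟩ with hY
  have hYc : ∀ c : 𝒜, (((Y c : W) : ℓ2) : (Fin 3 → ℤ) → ℂ³) = SymL2.coef w c := fun c => rfl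
  have hnorm : ∀ (c c' : 𝒜), ‖Y c - Y c'‖ ≤ ‖(c : SymL2 (Fin 3)) - c'‖ := by
    intro c c'
    rw [← norm_coeW]
    have h : ‖((Y c - Y c' : W) : ℓ2)‖ₑ ≤ ‖(c : SymL2 (Fin 3)) - c'‖ₑ := by
      refine (ENNReal.pow_le_pow_left_iff two_ne_zero).1 ?_
      rw [l2_enorm_sq_eq_tsum, coeW_sub, hYc, hYc]
      refine le_trans (le_of_eq (tsum_congr fun k => ?_)) (tsum_enorm_sq_coef_le ((c : SymL2 (Fin 3)) - c'))
      rw [Pi.sub_apply, SymL2.coef_sub]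
    rw [← ofReal_norm, ← ofReal_norm] at h
    exact (ENNReal.ofReal_le_ofReal_iff (norm_nonneg _)).1 h
  refine ⟨Y, fun c k => by rw [hYc, mFourierCoeff_force], fun c => ?_, hnorm⟩
  rw [← norm_coeW]
  have h : ‖((Y c : W) : ℓ2)‖ₑ ≤ ‖(c : SymL2 (Fin 3))‖ₑ := by
    refine (ENNReal.pow_le_pow_left_iff two_ne_zero).1 ?_
    rw [l2_enorm_sq_eq_tsum, hYc]
    exact tsum_enorm_sq_coef_le _
  rw [← ofReal_norm, ← ofReal_norm] at h
  exact (ENNReal.ofReal_le_ofReal_iff (norm_nonneg _)).1 h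

/-- The Leray symbol fixes the Fourier coefficients of an admissible force (transversal, no
mean mode). [folklore] -/
theorem lerayCoeff_mFourierCoeff_force (c : 𝒜) (k : Fin 3 → ℤ) :
    lerayCoeff k (mFourierCoeff (complexify ∘ F⟦c⟧) k) = mFourierCoeff (complexify ∘ F⟦c⟧) k := by
  obtain ⟨h0, htr⟩ := c.2
  by_cases hk : k = 0
  · subst hk
    rw [mFourierCoeff_force, SymL2.coef_apply, h0, smul_zero, lerayCoeff_zero_vec]
  · refine lerayCoeff_of_kdot_eq_zero hk ?_
    rw [mFourierCoeff_force, SymL2.coef_apply, kdot_smul, htr k, mul_zero]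

/-- The Fourier family of an admissible force is rapidly decaying. [folklore] -/
theorem rapidDecay_mFourierCoeff_force (c : SymL2 (Fin 3)) : RapidDecay (mFourierCoeff (complexify ∘ F⟦c⟧)) := by
  have e : mFourierCoeff (complexify ∘ F⟦c⟧) = SymL2.coef (fun k : Fin 3 → ℤ => Real.exp (freqNormSq k)) c :=
    funext (mFourierCoeff_force c)
  rw [e]
  exact forceDict_rapidDecay c

/-! ## §2 State vectors -/

include hW in
/-- **The state vector of a family.**  A rapidly decaying, transversal, conjugate-symmetric family
`a` has a state vector `x ∈ W` with coordinates `|k|² a(k)` and `cf x = a°` (the punctured family). [folklore] -/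
theorem exists_stateVec_of_family {a : (Fin 3 → ℤ) → ℂ³} (har : RapidDecay a)
    (hat : ∀ m : Fin 3 → ℤ, kdot[m, a m] = 0) (hacs : IsConjSymm a) :
    ∃ x : W, ((x : ℓ2) : (Fin 3 → ℤ) → ℂ³) = (fun k => ((freqNormSq k : ℝ) : ℂ) • a k) ∧
      cf[((x : ℓ2) : (Fin 3 → ℤ) → ℂ³)] = Function.update a 0 0 := by
  set X : (Fin 3 → ℤ) → ℂ³ := fun k => ((freqNormSq k : ℝ) : ℂ) • a k with hX
  have hXr : RapidDecay X := by
    refine har.of_norm_le_mul_pow (C := 1) (s := 1) fun k => ?_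
    rw [hX]
    dsimp only
    rw [norm_smul, Complex.norm_real, Real.norm_of_nonneg (freqNormSq_nonneg k), one_mul, pow_one]
    exact mul_le_mul_of_nonneg_right (by linarith [freqNormSq_nonneg k]) (norm_nonneg _)
  have hX0 : X 0 = 0 := by simp [hX, freqNormSq_zero]
  have hXV : ((X : (Fin 3 → ℤ) → ℂ³) 0 = 0 ∧ (∀ kk : Fin 3 → ℤ, kdot[kk, (X : (Fin 3 → ℤ) → ℂ³) kk] = 0) ∧
      IsConjSymm (X : (Fin 3 → ℤ) → ℂ³)) := by
    refine ⟨hX0, fun k => by rw [hX]; dsimp only; rw [kdot_smul, hat k, mul_zero], fun k => ?_⟩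
    rw [hX]
    dsimp only
    rw [freqNormSq_neg, hacs k, conjVec_smul, Complex.conj_ofReal]
  refine ⟨⟨⟨X, memℓp_two_of_rapidDecay hXr⟩, (hW _).2 hXV⟩, rfl, ?_⟩
  exact cf_weight_smul' a

include hW in
/-- **The state vector of a smooth divergence-free field** `u` (any mean): `x_u ∈ W` with
coordinates `|k|² û(k)` and `cf x_u = û°`. [folklore] -/
theorem exists_stateVec {u : 𝕋³ → E³} (hu : IsSmooth u) (hdiv : IsDivFree u) :
    ∃ x : W, ((x : ℓ2) : (Fin 3 → ℤ) → ℂ³) = (fun k => ((freqNormSq k : ℝ) : ℂ) • mFourierCoeff (complexify ∘ u) k) ∧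
      cf[((x : ℓ2) : (Fin 3 → ℤ) → ℂ³)] = Function.update (mFourierCoeff (complexify ∘ u)) 0 0 :=
  exists_stateVec_of_family hW hu.complexify_comp.rapidDecay_mFourierCoeff
    (fun m => hdiv.sum_mul_mFourierCoeff_eq_zero hu m) (isConjSymm_mFourierCoeff hu.integrable)

/-! ## §3 Classical steady states solve the drifted lattice equation -/

section Lattice

variable (B : W → W → W)
variable (hB : ∀ x y : W, (((B x y : W) : ℓ2) : (Fin 3 → ℤ) → ℂ³) = fun k =>
  lerayCoeff k nl[cf[((x : ℓ2) : (Fin 3 → ℤ) → ℂ³)], cf[((y : ℓ2) : (Fin 3 → ℤ) → ℂ³)], k])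
variable {M : ℂ³} (D : W →L[ℝ] W)
variable (hD : ∀ x : W, (((D x : W) : ℓ2) : (Fin 3 → ℤ) → ℂ³) = fun k =>
  (2 * Real.pi * Complex.I * kdot[k, M]) • cf[((x : ℓ2) : (Fin 3 → ℤ) → ℂ³)] k)

include hB hD in
/-- **A classical steady state solves the drifted lattice equation.**  If `(u, p)` is a classical
steady state of `NS_ν(F⟦c⟧)` with `û(0) = M`, `x ∈ W` has coordinates `|k|² û(k)` and `y ∈ W` has
coordinates `𝓕(F⟦c⟧)(k)`, then `4π²ν x + D_M x + B(x,x) = y`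
(`SteadyLatticeDrift.fourier_eq_drift_of_isSteadyNSState`). [folklore] -/
theorem steadyMap_stateVec_eq {ν : ℝ} {c : 𝒜} {u : 𝕋³ → E³} {p : 𝕋³ → ℝ}
    (hst : IsSteadyNSState ν F⟦c⟧ u p) (hM : mFourierCoeff (complexify ∘ u) 0 = M)
    (x : W) (hx : ((x : ℓ2) : (Fin 3 → ℤ) → ℂ³) = fun k => ((freqNormSq k : ℝ) : ℂ) • mFourierCoeff (complexify ∘ u) k)
    (y : W) (hy : ∀ k, (((y : W) : ℓ2) : (Fin 3 → ℤ) → ℂ³) k = mFourierCoeff (complexify ∘ F⟦c⟧) k) :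
    (4 * Real.pi ^ 2 * ν) • x + D x + B x x = y := by
  set a : (Fin 3 → ℤ) → ℂ³ := mFourierCoeff (complexify ∘ u) with ha
  have hx0 : ((x : ℓ2) : (Fin 3 → ℤ) → ℂ³) 0 = 0 := by rw [hx]; simp [freqNormSq_zero]
  have hcf : cf[((x : ℓ2) : (Fin 3 → ℤ) → ℂ³)] = Function.update a 0 0 := by rw [hx]; exact cf_weight_smul' a
  refine Subtype.ext (lp.ext (funext fun k => ?_))
  have h := fourier_eq_drift_of_isSteadyNSState hst (forceDict_isSmooth (c : SymL2 (Fin 3))) k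
  rw [lerayCoeff_mFourierCoeff_force c k, ← hy k, ← ha, hM, ← hcf] at h
  rw [coeW_add, coeW_add, coeW_smul, hB, hD]
  simp only [Pi.add_apply, Pi.smul_apply]
  rw [← Complex.coe_smul, smul_eq_weight_smul_cf hx0 k]
  exact h

include hW hB hD in
/-- **A lattice solution is a classical steady state.**  If `x ∈ W` solves
`4π²ν x + D_M x + B(x,x) = y` with `y` the force vector of `c ∈ 𝒜`, `ν > 0`, `conj M = M`, then there
is a classical steady state `(u, p)` of `NS_ν(F⟦c⟧)` with `𝓕u = cf x + δ₀ M` (so `û(0) = M` and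
`x` is its state vector): lattice elliptic regularity `rapidDecay_of_perturbed_eq` and the synthesis
`steadyState_of_fourier'`. [folklore] -/
theorem exists_steadyState_of_latticeEq (hM : conjVec M = M) {ν : ℝ} (hν : 0 < ν) (c : 𝒜) (x y : W)
    (hy : ∀ k, (((y : W) : ℓ2) : (Fin 3 → ℤ) → ℂ³) k = mFourierCoeff (complexify ∘ F⟦c⟧) k)
    (heq : (4 * Real.pi ^ 2 * ν) • x + D x + B x x = y) :
    ∃ (u : 𝕋³ → E³) (p : 𝕋³ → ℝ), IsSteadyNSState ν F⟦c⟧ u p ∧ IsSmooth u ∧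
      mFourierCoeff (complexify ∘ u) = cf[((x : ℓ2) : (Fin 3 → ℤ) → ℂ³)] + (Pi.single (0 : Fin 3 → ℤ) M : (Fin 3 → ℤ) → ℂ³) := by
  obtain ⟨hfs, hfd, hf0⟩ := stub_forceDictionary c
  set cν : ℝ := 4 * Real.pi ^ 2 * ν with hcν
  -- coordinates of the equation
  have hxeq : ∀ k : Fin 3 → ℤ, (((cν : ℝ)) : ℂ) • ((x : ℓ2) : (Fin 3 → ℤ) → ℂ³) k +
      (2 * Real.pi * Complex.I * kdot[k, M]) • cf[((x : ℓ2) : (Fin 3 → ℤ) → ℂ³)] k +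
      lerayCoeff k nl[cf[((x : ℓ2) : (Fin 3 → ℤ) → ℂ³)], cf[((x : ℓ2) : (Fin 3 → ℤ) → ℂ³)], k] =
      mFourierCoeff (complexify ∘ F⟦c⟧) k := by
    intro k
    have h := congrArg (fun z : W => (((z : W) : ℓ2) : (Fin 3 → ℤ) → ℂ³) k) heq
    dsimp only at h
    rw [coeW_add, coeW_add, coeW_smul, hB, hD, hy] at h
    simpa only [Pi.add_apply, Pi.smul_apply, Complex.coe_smul] using h
  have hxr : RapidDecay cf[((x : ℓ2) : (Fin 3 → ℤ) → ℂ³)] :=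
    rapidDecay_of_perturbed_eq hν (rapidDecay_single M) (single_transversal M) (x : ℓ2) (W_trans hW x)
      (fun s => tsum_weight_mul_enorm_ne_top_of_rapidDecay (rapidDecay_mFourierCoeff_force (c : SymL2 (Fin 3))) s)
      (fun k => by
        rw [leray_nl_linearised_single M (W_trans hW x) k, ← hcν]
        exact hxeq k)
  -- the full family
  set c₁ : (Fin 3 → ℤ) → ℂ³ := cf[((x : ℓ2) : (Fin 3 → ℤ) → ℂ³)] + (Pi.single (0 : Fin 3 → ℤ) M : (Fin 3 → ℤ) → ℂ³)
    with hc₁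
  have hc₁r : RapidDecay c₁ := hxr.add (rapidDecay_single _)
  have hc₁cs : IsConjSymm c₁ := (isConjSymm_cf (W_conj hW x)).add (isConjSymm_single hM)
  have hc₁t : ∀ k : Fin 3 → ℤ, kdot[k, c₁ k] = 0 := fun k => by
    rw [hc₁, Pi.add_apply, kdot_add, cf_transversal (W_trans hW x) k, single_transversal, add_zero]
  have hupd : Function.update c₁ 0 0 = cf[((x : ℓ2) : (Fin 3 → ℤ) → ℂ³)] := update_add_single_of_zero (cf_zero _) _
  have hc₁0 : c₁ 0 = M := add_single_apply_zero (cf_zero _) _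
  have heq₁ : ∀ k : Fin 3 → ℤ, (((ν * (4 * Real.pi ^ 2 * freqNormSq k)) : ℝ) : ℂ) • c₁ k +
      lerayCoeff k nl[c₁, c₁, k] = mFourierCoeff (complexify ∘ F⟦c⟧) k := by
    intro k
    rw [leray_nl_self_update hc₁r hc₁t k, ← weight_smul_update c₁ k, hupd, hc₁0, ← hxeq k,
      smul_eq_weight_smul_cf (W_zero hW x) k]
    abel
  obtain ⟨u, p, hst, hu, hû⟩ := steadyState_of_fourier' hfs hfd hf0 hc₁r hc₁cs hc₁t heq₁
  exact ⟨u, p, hst, hu, hû⟩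

end Lattice

/-! ## §4 A classical kernel field yields a lattice kernel vector -/

section Kernel

variable (B : W → W → W)
variable (hB : ∀ x y : W, (((B x y : W) : ℓ2) : (Fin 3 → ℤ) → ℂ³) = fun k =>
  lerayCoeff k nl[cf[((x : ℓ2) : (Fin 3 → ℤ) → ℂ³)], cf[((y : ℓ2) : (Fin 3 → ℤ) → ℂ³)], k])

/-- `cplx v = complexify ∘ v`. [folklore] -/
theorem cplx_eq_complexify_comp (v : 𝕋³ → E³) : cplx v = complexify ∘ v := by
  funext x
  exact realToComplex_eq_complexify (v x)

include hW hB in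
/-- **A classical kernel field of the linearisation yields a non-zero lattice kernel vector**
(converse of the landed `stub_linearisationInjective`).  With `a = 𝓕u`, base point `x₀`
(`cf x₀ = a°`), drift `D` for the mean `a(0)` and `K w = B(x₀,w) + B(w,x₀)`: if `L(ν,u)` has a
classical kernel field in the mean-zero class (`IsLinNSEigenvalue ν u 0`), then it has a REAL one
`v ≠ 0` (`stub_realKernel`), whose lattice family `b = 𝓕(complexify ∘ v)` solves the projected
linearised lattice equation against the full family `a` (`latticeEq_of_linNSResolventRel`); the state
vector `w` of `b` (`w(k) = |k|² b(k)`, in `W` since `b` is conjugate symmetric, transversal, `b(0) = 0`)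
is then a non-zero kernel vector of `4π²ν + (D + K)`. [folklore] -/
theorem exists_kernel_of_isLinNSEigenvalue {ν : ℝ} {u : 𝕋³ → E³} (D K : W →L[ℝ] W) (x₀ : W)
    (hu : IsSmooth u)
    (hD : ∀ x : W, (((D x : W) : ℓ2) : (Fin 3 → ℤ) → ℂ³) = fun k =>
      (2 * Real.pi * Complex.I * kdot[k, mFourierCoeff (complexify ∘ u) 0]) • cf[((x : ℓ2) : (Fin 3 → ℤ) → ℂ³)] k)
    (hKw : ∀ w, K w = B x₀ w + B w x₀)
    (hcf : cf[((x₀ : ℓ2) : (Fin 3 → ℤ) → ℂ³)] = Function.update (mFourierCoeff (complexify ∘ u)) 0 0)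
    (hev : IsLinNSEigenvalue ν u 0) :
    ∃ w : W, w ≠ 0 ∧ (4 * Real.pi ^ 2 * ν) • w + (D + K) w = 0 := by
  set a : (Fin 3 → ℤ) → ℂ³ := mFourierCoeff (complexify ∘ u) with ha
  have har : RapidDecay a := hu.complexify_comp.rapidDecay_mFourierCoeff
  -- a real kernel field
  obtain ⟨v, hv0, hrel⟩ := Poly.RealKernel.stub_realKernel ν u hu hev
  have hlat := LsTransfer.latticeEq_of_linNSResolventRel hu hrel
  obtain ⟨hvs, hvdiv, hvmean, -⟩ := hrel
  rw [cplx_eq_complexify_comp] at hvs hvdiv hvmean hlat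
  set b : (Fin 3 → ℤ) → ℂ³ := mFourierCoeff (complexify ∘ v) with hb
  have hbr : RapidDecay b := hvs.rapidDecay_mFourierCoeff
  have hbt : ∀ m : Fin 3 → ℤ, kdot[m, b m] = 0 := fun m => KolmogorovShear.kdot_mFourierCoeff_eq_zero hvs hvdiv m
  have hb0 : b 0 = 0 := mFourierCoeff_zero_of_hasZeroMean hvmean
  have hvr : IsSmooth v := by
    have h := hvs.comp_clm EuclideanSpace.realPart
    have e : (⇑EuclideanSpace.realPart ∘ (complexify ∘ v)) = v := by
      funext y
      simp [Function.comp, EuclideanSpace.realPart_complexify]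
    rwa [e] at h
  have hbcs : IsConjSymm b := isConjSymm_mFourierCoeff hvr.integrable
  -- its state vector
  obtain ⟨w, hw, hcfw⟩ := exists_stateVec_of_family hW hbr hbt hbcs
  have hupd : Function.update b 0 0 = b := by
    rw [Function.update_eq_iff]
    exact ⟨hb0.symm, fun _ _ => rfl⟩
  rw [hupd] at hcfw
  refine ⟨w, fun hw0 => hv0 ?_, ?_⟩
  · -- `w = 0` forces `b = 0`, hence `v = 0`
    have hb00 : ∀ k, b k = 0 := by
      intro k
      have h := congrFun hcfw k
      rw [hw0, Submodule.coe_zero] at h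
      rw [← h]
      simp
    have hcv : (complexify ∘ v) = 0 := eq_zero_of_forall_mFourierCoeff_eq_zero hvs.continuous hb00
    funext y
    have := congrFun hcv y
    simp only [Function.comp_apply, Pi.zero_apply] at this
    apply complexify_injective
    rw [Pi.zero_apply, map_zero]
    exact this
  · -- the coordinates of `(4π²ν) w + (D + K) w` vanish
    refine Subtype.ext (lp.ext (funext fun k => ?_))
    rw [Submodule.coe_zero, coeW_add, add_apply, coeW_add, hKw, coeW_add, coeW_smul, hB, hB,
      hD, hcf, hcfw]
    simp only [Pi.add_apply, Pi.smul_apply]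
    change ((4 * Real.pi ^ 2 * ν : ℝ) : ℂ) • ((w : ℓ2) : (Fin 3 → ℤ) → ℂ³) k +
      ((2 * Real.pi * Complex.I * kdot[k, a 0]) • b k +
        (lerayCoeff k nl[Function.update a 0 0, b, k] + lerayCoeff k nl[b, Function.update a 0 0, k])) =
      (0 : (Fin 3 → ℤ) → ℂ³) k
    have h := hlat k
    have hzero : mFourierCoeff (0 : 𝕋³ → ℂ³) k = 0 := by
      rw [show (0 : 𝕋³ → ℂ³) = (0 : ℂ) • (0 : 𝕋³ → ℂ³) by simp, mFourierCoeff_const_smul, zero_smul]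
    rw [hzero, lerayCoeff_zero_vec, neg_zero, ← ha, ← hcfw,
      leray_nl_linearised_update har (w : ℓ2) (W_trans hW w) k, hcfw] at h
    rw [Pi.zero_apply, smul_eq_weight_smul_cf (W_zero hW w) k, hcfw]
    calc _ = (((ν * (4 * Real.pi ^ 2 * freqNormSq k)) : ℝ) : ℂ) • b k +
          (lerayCoeff k nl[Function.update a 0 0, b, k] + lerayCoeff k nl[b, Function.update a 0 0, k] +
            (2 * Real.pi * Complex.I * kdot[k, a 0]) • b k) := by abel
      _ = 0 := h

end Kernel

/-! ## §5 Registered sub-goal -/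

/-- **Registered sub-goal `genericLeaf_toolsC`** (worker B of stub `stub_genericLeafNondegeneracy`):
`exists_kernel_of_isLinNSEigenvalue` in Pi-form — a classical kernel field of `L(ν,u)` in the mean-zero
class yields a non-zero kernel vector of the lattice linearisation `4π²ν + (D + K)`. [folklore] -/
theorem genericLeaf_toolsC : ∀ (W : Submodule ℝ ℓ2), (∀ x : ℓ2, x ∈ W ↔ (((x : ℓ2) : (Fin 3 → ℤ) → ℂ³) 0 = 0 ∧ (∀ kk : Fin 3 → ℤ, kdot[kk, ((x : ℓ2) : (Fin 3 → ℤ) → ℂ³) kk] = 0) ∧ IsConjSymm ((x : ℓ2) : (Fin 3 → ℤ) → ℂ³))) → ∀ (B : W → W → W), (∀ x y : W, (((B x y : W) : ℓ2) : (Fin 3 → ℤ) → ℂ³) = fun k => lerayCoeff k nl[cf[((x : ℓ2) : (Fin 3 → ℤ) → ℂ³)], cf[((y : ℓ2) : (Fin 3 → ℤ) → ℂ³)], k]) → ∀ (ν : ℝ) (u : 𝕋³ → E³) (D K : W →L[ℝ] W) (x₀ : W), IsSmooth u → (∀ x : W, (((D x : W) : ℓ2) : (Fin 3 → ℤ) →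 ℂ³) = fun k => (2 * Real.pi * Complex.I * kdot[k, mFourierCoeff (complexify ∘ u) 0]) • cf[((x : ℓ2) : (Fin 3 → ℤ) → ℂ³)] k) → (∀ w, K w = B x₀ w + B w x₀) → cf[((x₀ : ℓ2) : (Fin 3 → ℤ) → ℂ³)] = Function.update (mFourierCoeff (complexify ∘ u)) 0 0 → IsLinNSEigenvalue ν u 0 → ∃ w : W, w ≠ 0 ∧ (4 * Real.pi ^ 2 * ν) • w + (D + K) w = 0 :=
  fun _ hW B hB _ _ D K x₀ hu hD hKw hcf hev => exists_kernel_of_isLinNSEigenvalue hW B hB D K x₀ hu hD hKw hcf hev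

end Summit.AnomalousDissipation.AnomalousDissipation.Theorems.WindLineWindyGalerkinSteadyZerothLaw.GenericLeaf

end
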